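import Summits.AtomisticToContinuum.HydrodynamicLimit.Theses.CollisionIsometryCLT

/-!
# Line `kinship-lyapunov` for the crux `DiffuseBackwardInfluence` (stmt-AtomisticToContinuum-12950)

Route `CollisionIsometryCLT`, crux rank 3: along the local-Gibbs-evolved law the rows of the exact
backward velocity transfer `M` over every admissible window delocalise in mean,
`E[(N+1)⁻¹ Σᵢ Σₖ ‖M_ik‖_F⁴] → 0`.

## The lever (idea card `kinship-lyapunov`, triage r1-1: pass)

Write `a_ik(m) = ‖M_ik(m)‖_F²` for the block weights of the transfer after `m` fold steps
(`Σₖ a_ik = 3`: every row is a probability vector of mass 3 on the ancestors `k`), `ipr_i = Σₖ a_ik²`,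
`I = Σᵢ ipr_i ∈ [9, 9(N+1)]`, `I(0) = 9(N+1)`. A fold step reflecting the incoming pair `(p,q)` with
normal `ν` (`P = νν̂ᵀ`) acts on the blocks by `M_pk ← (1−P)M_pk + P M_qk`, `M_qk ← (1−P)M_qk + P M_pk`,
hence on the weights by the EXACT swap rule
  `a_pk ← a_pk − x_k + y_k`, `a_qk ← a_qk + x_k − y_k`, `x_k = ‖P M_pk‖_F² ∈ [0,a_pk]`,
  `y_k = ‖P M_qk‖_F² ∈ [0,a_qk]`, `Σₖ x_k = Σₖ y_k = 1`
(one unit of row weight is exchanged whatever the normal), all other rows unchanged, and therefore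
  `I(m+1) − I(m) = 2 Σₖ (x_k − y_k)((x_k − y_k) − (a_pk − a_qk))`            (kinship identity).
For an isotropic normal independent of the blocks `x_k ≈ a_pk/3`, `y_k ≈ a_qk/3` and the identity
reads `ΔI ≈ −(4/9)·D`, `D := Σₖ (a_pk − a_qk)² = ipr_p + ipr_q − 2 K_pq` (`K_pq = Σₖ a_pk a_qk` the
kinship of the pair): the total participation `I` is a Lyapunov function IN MEAN of a randomised
pairwise-averaging ("gossip") process on the rows, whose dissipation at each collision is the ROW
DISCREPANCY of the colliding pair; on cycle-free histories (`K_pq = 0`) it is a Lyapunov function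
pathwise and for arbitrary normals (`y_k = 0 ⇒` term `≤ 0`).

## The skeleton (5 stubs ⟹ crux, composition `DiffuseBackwardInfluence_of` kernel-checked)

* `stub_kinship`   — the exact bookkeeping above for the typed fold (deterministic algebra; M).
* `stub_drift`     — NO CONSPIRACY (load-bearing, hardest): given the bookkeeping, for small σ there
  is `κ > 0` such that, uniformly over sub-intervals `[s₁,s₂]` of the window,
  `E[I(s₂)] + κ·E[Σ_{collisions in (s₁,s₂]} D] ≤ E[I(s₁)] + o(N+1)`: the realised (velocity-selected)
  normals achieve on average a fixed fraction of perfect averaging, net of recollision ("clone")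
  collisions and of the `O(n_N) = o(N)` isotropic noise floor (L/XL).
* `stub_fewIdle`   — every particle but `o(N)` in mean collides in every epoch `Δ_N/L` of the window
  (`n_N/L → ∞` mean free times), `L` fixed (the `m = 0` case of FewCollisionsRare; L).
* `stub_supply`    — given few idle particles, the collisions of each epoch dissipate discrepancy
  `≥ c·I(epoch start)` up to `o(N+1)` (first collisions of an epoch meet rows that are not clones of
  one's own; transient closed clusters carry no macroscopic share of the participation; L).
* `stub_reduction` — bookkeeping + drift + supply ⟹ `E[ipr] → 0` (epochs, telescoping in mean,
  `limsup_N E[ipr] ≤ 9/(κ c L)`, then `L → ∞`; analysis/measure theory, M).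

Disproof used: no `Disproof.lean` exists for this crux at the time of writing (`ledger crux ls`);
no landed `Negative/` lemma. Dead lines: none recorded for this crux.

Toy evidence (kit j007629 N=512, j007631 N=1024; exact block transfer on a stochastic hard-sphere-type
collision process, |g·ω|-biased vs blind normals, uniform vs local partners): identity / `Σx = 1` /
orthogonality residuals ≤ 1e-14; per-epoch `κ = −ΣΔI/ΣD` = 0.435 (fresh) → 0.27 (12 coll./particle) → 0.24
(24), N-independent while `I ≫ 11`, dropping to ≈ 0 only at the Haar floor `I → 11.0` where the partner
kinship ratio `2K/(ipr_p+ipr_q) → 0.80`; ≤ 4 % of collisions have `ΔI > 0` before the floor.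
-/

namespace Summit.AtomisticToContinuum.HydrodynamicLimit.Cruxes.DiffuseBackwardInfluence.KinshipLyapunov

open scoped BigOperators Topology Classical MeasureTheory ENNReal InnerProductSpace
open Filter Set MeasureTheory

noncomputable section

/-! ## The typed transfer, step by step (verbatim `let`s of the crux) -/

/-- Phase space of `N + 1` spheres on `𝕋³` (the crux's configuration type). -/
abbrev Cfg (N : ℕ) : Type :=
  Literature.Analysis.FluidPDE.Config (N + 1) (Fin 3) (UnitAddTorus (Fin 3))

/-- Velocity fields of `N + 1` spheres. -/
abbrev Vel (N : ℕ) : Type := Fin (N + 1) → EuclideanSpace ℝ (Fin 3)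

/-- Families of hard-sphere flows at reduced density `σ` (the crux's `Φ`). -/
abbrev Flows (σ : ℝ) : Type :=
  (N : ℕ) → Literature.Analysis.FluidPDE.HardSphereFlow
    (Literature.Analysis.FluidPDE.Torus.geometry (Fin 3))
    (Literature.MathematicalPhysics.KineticTheory.hsDiameter σ N) (N + 1)

/-- The pre-collisional configuration ending the `k`-th free flight of the Alexander construction
started at `y` (the crux's `pre k`, verbatim). -/
def pre (σ : ℝ) (N : ℕ) (y : Cfg N) (k : ℕ) : Cfg N :=
  Literature.Analysis.FluidPDE.freeFlight (Literature.Analysis.FluidPDE.Torus.geometry (Fin 3))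
    (Literature.Analysis.FluidPDE.Alexander.freeExitTime
      (Literature.Analysis.FluidPDE.Torus.geometry (Fin 3))
      (Literature.MathematicalPhysics.KineticTheory.hsDiameter σ N)
      (Literature.Analysis.FluidPDE.Alexander.stateAfter
        (Literature.Analysis.FluidPDE.Torus.geometry (Fin 3))
        (Literature.MathematicalPhysics.KineticTheory.hsDiameter σ N) y k)).toReal
    (Literature.Analysis.FluidPDE.Alexander.stateAfter
      (Literature.Analysis.FluidPDE.Torus.geometry (Fin 3))
      (Literature.MathematicalPhysics.KineticTheory.hsDiameter σ N) y k)

/-- One fold step of the crux's transfer: the velocity part of `collidePair` at the realised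
incoming pair of `pre k` (the identity if there is none), applied to a velocity field `W` placed at
the positions of `pre k` (verbatim the crux's `fun W' k => dite …`). -/
def stepMap (σ : ℝ) (N : ℕ) (y : Cfg N) (k : ℕ) (W : Vel N) : Vel N :=
  @dite (Fin (N + 1) → EuclideanSpace ℝ (Fin 3))
    (Literature.Analysis.FluidPDE.Alexander.incomingPairs
      (Literature.Analysis.FluidPDE.Torus.geometry (Fin 3))
      (Literature.MathematicalPhysics.KineticTheory.hsDiameter σ N) (pre σ N y k)).Nonempty
    (Classical.propDecidable _)
    (fun h => fun i => (Literature.Analysis.FluidPDE.collidePair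
      (Literature.Analysis.FluidPDE.Torus.geometry (Fin 3)) h.some.1 h.some.2
      (fun j => ((pre σ N y k j).1, W j)) i).2)
    (fun _ => W)

/-- The transfer after the first `m` fold steps, `M(m) W`; the crux's `M N y Δ W` is
`transferSteps σ N y (steps σ N y Δ) W`. -/
def transferSteps (σ : ℝ) (N : ℕ) (y : Cfg N) (m : ℕ) (W : Vel N) : Vel N :=
  (List.range m).foldl (fun W' k => stepMap σ N y k W') W

/-- The number of fold steps whose collision instant lies in the closed window `[0, s]`
(the crux's `collisionCount`). -/
def steps (σ : ℝ) (N : ℕ) (y : Cfg N) (s : ℝ) : ℕ :=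
  Literature.Analysis.FluidPDE.Alexander.collisionCount
    (Literature.Analysis.FluidPDE.Torus.geometry (Fin 3))
    (Literature.MathematicalPhysics.KineticTheory.hsDiameter σ N) y s

/-- The incoming pair reflected at fold step `k` (`none` if the step is the identity). -/
def stepPair (σ : ℝ) (N : ℕ) (y : Cfg N) (k : ℕ) : Option (Fin (N + 1) × Fin (N + 1)) :=
  @dite (Option (Fin (N + 1) × Fin (N + 1)))
    (Literature.Analysis.FluidPDE.Alexander.incomingPairs
      (Literature.Analysis.FluidPDE.Torus.geometry (Fin 3))
      (Literature.MathematicalPhysics.KineticTheory.hsDiameter σ N) (pre σ N y k)).Nonempty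
    (Classical.propDecidable _)
    (fun h => some h.some) (fun _ => none)

/-- Particle `i` takes part in fold step `k`. -/
def Involved (σ : ℝ) (N : ℕ) (y : Cfg N) (k : ℕ) (i : Fin (N + 1)) : Prop :=
  ∃ pq : Fin (N + 1) × Fin (N + 1), stepPair σ N y k = some pq ∧ (i = pq.1 ∨ i = pq.2)

/-! ## Block weights, participation, discrepancy -/

/-- Block weight `a_ik(m) = ‖M_ik(m)‖_F² = Σₐ ‖M(m)(e_k ⊗ e_a)_i‖²` (verbatim the crux's summand). -/
def blockWeight (σ : ℝ) (N : ℕ) (y : Cfg N) (m : ℕ) (i k : Fin (N + 1)) : ℝ :=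
  ∑ a : Fin 3, ‖transferSteps σ N y m (Pi.single k (EuclideanSpace.single a (1 : ℝ))) i‖ ^ 2

/-- Row participation `ipr_i(m) = Σₖ a_ik(m)²`. -/
def rowIpr (σ : ℝ) (N : ℕ) (y : Cfg N) (m : ℕ) (i : Fin (N + 1)) : ℝ :=
  ∑ k : Fin (N + 1), (blockWeight σ N y m i k) ^ 2

/-- Total participation `I(m) = Σᵢ ipr_i(m)`; the crux's `ipr N y Δ` is
`(N+1)⁻¹ · participation σ N y (steps σ N y Δ)`. -/
def participation (σ : ℝ) (N : ℕ) (y : Cfg N) (m : ℕ) : ℝ :=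
  ∑ i : Fin (N + 1), rowIpr σ N y m i

/-- Row discrepancy of the pair reflected at step `m`, measured before the step:
`D_m = Σₖ (a_pk(m) − a_qk(m))² = ipr_p + ipr_q − 2 K_pq` (`0` if the step is the identity). -/
def discrepancy (σ : ℝ) (N : ℕ) (y : Cfg N) (m : ℕ) : ℝ :=
  match stepPair σ N y m with
  | none => 0
  | some pq => ∑ k : Fin (N + 1), (blockWeight σ N y m pq.1 k - blockWeight σ N y m pq.2 k) ^ 2

/-- Discrepancy dissipated by the fold steps `m₁ ≤ m < m₂`. -/
def dissipation (σ : ℝ) (N : ℕ) (y : Cfg N) (m₁ m₂ : ℕ) : ℝ :=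
  ∑ m ∈ Finset.Ico m₁ m₂, discrepancy σ N y m

/-- Number of particles taking part in none of the fold steps `m₁ ≤ m < m₂`. -/
def idleCount (σ : ℝ) (N : ℕ) (y : Cfg N) (m₁ m₂ : ℕ) : ℕ :=
  (Finset.univ.filter fun i : Fin (N + 1) => ∀ m ∈ Finset.Ico m₁ m₂, ¬ Involved σ N y m i).card

/-! ## The statements of the line -/

/-- Continuous, positive profiles (the crux's hypotheses on `a₀, θ₀, u₀`). -/
def NiceProfiles (a₀ θ₀ : UnitAddTorus (Fin 3) → ℝ)
    (u₀ : UnitAddTorus (Fin 3) → EuclideanSpace ℝ (Fin 3)) : Prop :=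
  Continuous a₀ ∧ Continuous θ₀ ∧ Continuous u₀ ∧ (∀ x, 0 < a₀ x) ∧ (∀ x, 0 < θ₀ x)

/-- Admissible windows (the crux's hypotheses on `Δ`): `Δ_N > 0`, `Δ_N → 0`,
`Δ_N (N+1)^{1/3} → ∞`. -/
def AdmissibleWindow (Δ : ℕ → ℝ) : Prop :=
  (∀ N, 0 < Δ N) ∧ Tendsto Δ atTop (𝓝 0) ∧
    Tendsto (fun N : ℕ => Δ N * ((N + 1 : ℕ) : ℝ) ^ ((1 : ℝ) / 3)) atTop atTop

/-- KINSHIP — the exact per-collision bookkeeping of the typed transfer. For every `N`, `y` and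
fold step `m`: (budget) every row has weight `Σₖ a_ik(m) = 3`; (locality) rows of particles not
reflected at step `m` are unchanged; (swap) if step `m` reflects the incoming pair `(p, q)` there
are transferred normal weights `x_k ∈ [0, a_pk(m)]`, `w_k ∈ [0, a_qk(m)]` of unit total mass each
(one unit of row weight is exchanged whatever the normal: `x_k = ‖P_ν M_pk‖_F²`) with
`a_pk(m+1) = a_pk(m) − x_k + w_k`, `a_qk(m+1) = a_qk(m) + x_k − w_k`, and the kinship identity
`I(m+1) − I(m) = 2 Σₖ (x_k − w_k)((x_k − w_k) − (a_pk(m) − a_qk(m)))`. -/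
def Kinship (σ : ℝ) : Prop :=
  ∀ (N : ℕ) (y : Cfg N) (m : ℕ),
    (∀ i : Fin (N + 1), ∑ k : Fin (N + 1), blockWeight σ N y m i k = 3) ∧
    (∀ i : Fin (N + 1), ¬ Involved σ N y m i →
      ∀ k : Fin (N + 1), blockWeight σ N y (m + 1) i k = blockWeight σ N y m i k) ∧
    (∀ p q : Fin (N + 1), stepPair σ N y m = some (p, q) →
      ∃ x w : Fin (N + 1) → ℝ,
        (∀ k, 0 ≤ x k ∧ x k ≤ blockWeight σ N y m p k ∧ 0 ≤ w k ∧ w k ≤ blockWeight σ N y m q k) ∧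
        ∑ k, x k = 1 ∧ ∑ k, w k = 1 ∧
        (∀ k, blockWeight σ N y (m + 1) p k = blockWeight σ N y m p k - x k + w k ∧
          blockWeight σ N y (m + 1) q k = blockWeight σ N y m q k + x k - w k) ∧
        participation σ N y (m + 1) - participation σ N y m =
          2 * ∑ k, (x k - w k) * ((x k - w k) - (blockWeight σ N y m p k - blockWeight σ N y m q k)))

/-- DRIFT at rate `κ` (no conspiracy of the realised normals with the transferred blocks):
uniformly over sub-intervals `[s₁, s₂] ⊆ [0, Δ_N]` of the window started at `y = Φ_{t−Δ_N} z`,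
`E[I(s₂)] + κ · E[Σ_{steps in (s₁,s₂]} D] ≤ E[I(s₁)] + ε_N (N+1)` with `ε_N → 0`, expectations
under the local Gibbs law. (Generic isotropic value `κ = 4/9` minus the rank-one noise floor; the
`O(n_N) = o(N+1)` equilibrium floor and finitely many bad `N` sit in `ε_N`.) -/
def DriftAt (κ σ : ℝ) (a₀ θ₀ : UnitAddTorus (Fin 3) → ℝ)
    (u₀ : UnitAddTorus (Fin 3) → EuclideanSpace ℝ (Fin 3)) (Φ : Flows σ) (Δ : ℕ → ℝ) (t : ℝ) :
    Prop :=
  ∃ err : ℕ → ℝ, Tendsto err atTop (𝓝 0) ∧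
    ∀ (N : ℕ) (s₁ s₂ : ℝ), 0 ≤ s₁ → s₁ ≤ s₂ → s₂ ≤ Δ N →
      (∫⁻ z, ENNReal.ofReal (participation σ N ((Φ N).flow (t - Δ N) z)
          (steps σ N ((Φ N).flow (t - Δ N) z) s₂))
        ∂(Literature.MathematicalPhysics.KineticTheory.localGibbsLaw σ a₀ u₀ θ₀ N (Φ N))) +
      ENNReal.ofReal κ *
        ∫⁻ z, ENNReal.ofReal (dissipation σ N ((Φ N).flow (t - Δ N) z)
          (steps σ N ((Φ N).flow (t - Δ N) z) s₁) (steps σ N ((Φ N).flow (t - Δ N) z) s₂))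
        ∂(Literature.MathematicalPhysics.KineticTheory.localGibbsLaw σ a₀ u₀ θ₀ N (Φ N))
      ≤ (∫⁻ z, ENNReal.ofReal (participation σ N ((Φ N).flow (t - Δ N) z)
          (steps σ N ((Φ N).flow (t - Δ N) z) s₁))
        ∂(Literature.MathematicalPhysics.KineticTheory.localGibbsLaw σ a₀ u₀ θ₀ N (Φ N))) +
        ENNReal.ofReal (err N * ((N + 1 : ℕ) : ℝ))

/-- FEW IDLE PARTICLES on the epochs of `L` equal parts of the window: the mean number of
(particle, epoch) pairs such that the particle takes part in no fold step of the epoch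
`(ℓ Δ_N / L, (ℓ+1) Δ_N / L]` is `o(N+1)`. -/
def FewIdleAt (σ : ℝ) (a₀ θ₀ : UnitAddTorus (Fin 3) → ℝ)
    (u₀ : UnitAddTorus (Fin 3) → EuclideanSpace ℝ (Fin 3)) (Φ : Flows σ) (Δ : ℕ → ℝ) (t : ℝ)
    (L : ℕ) : Prop :=
  Tendsto (fun N : ℕ => ((N + 1 : ℕ) : ℝ≥0∞)⁻¹ *
    ∫⁻ z, (∑ ℓ ∈ Finset.range L,
      (idleCount σ N ((Φ N).flow (t - Δ N) z)
        (steps σ N ((Φ N).flow (t - Δ N) z) ((ℓ : ℝ) * Δ N / (L : ℝ)))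
        (steps σ N ((Φ N).flow (t - Δ N) z) (((ℓ : ℝ) + 1) * Δ N / (L : ℝ))) : ℝ≥0∞))
      ∂(Literature.MathematicalPhysics.KineticTheory.localGibbsLaw σ a₀ u₀ θ₀ N (Φ N)))
    atTop (𝓝 0)

/-- SUPPLY at fraction `c` on `L` epochs: the collisions of the epochs dissipate discrepancy at
least `c` times the participation present at the epoch starts, up to `o(N+1)` in mean:
`(N+1)⁻¹ E[(Σ_{ℓ<L} (c · I(s_ℓ) − Σ_{steps in epoch ℓ} D))⁺] → 0`, `s_ℓ = ℓ Δ_N / L`. -/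
def SupplyAt (c σ : ℝ) (a₀ θ₀ : UnitAddTorus (Fin 3) → ℝ)
    (u₀ : UnitAddTorus (Fin 3) → EuclideanSpace ℝ (Fin 3)) (Φ : Flows σ) (Δ : ℕ → ℝ) (t : ℝ)
    (L : ℕ) : Prop :=
  Tendsto (fun N : ℕ => ((N + 1 : ℕ) : ℝ≥0∞)⁻¹ *
    ∫⁻ z, ENNReal.ofReal (∑ ℓ ∈ Finset.range L,
      (c * participation σ N ((Φ N).flow (t - Δ N) z)
          (steps σ N ((Φ N).flow (t - Δ N) z) ((ℓ : ℝ) * Δ N / (L : ℝ))) -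
        dissipation σ N ((Φ N).flow (t - Δ N) z)
          (steps σ N ((Φ N).flow (t - Δ N) z) ((ℓ : ℝ) * Δ N / (L : ℝ)))
          (steps σ N ((Φ N).flow (t - Δ N) z) (((ℓ : ℝ) + 1) * Δ N / (L : ℝ)))))
      ∂(Literature.MathematicalPhysics.KineticTheory.localGibbsLaw σ a₀ u₀ θ₀ N (Φ N)))
    atTop (𝓝 0)

/-- The conclusion of the crux at `(σ, profiles, Φ, Δ, t)`: mean inverse participation ratio of
the transfer over `[t − Δ_N, t]` tends to `0` (definitionally the crux's `Tendsto …`). -/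
def Delocalises (σ : ℝ) (a₀ θ₀ : UnitAddTorus (Fin 3) → ℝ)
    (u₀ : UnitAddTorus (Fin 3) → EuclideanSpace ℝ (Fin 3)) (Φ : Flows σ) (Δ : ℕ → ℝ) (t : ℝ) :
    Prop :=
  Tendsto (fun N : ℕ => ∫⁻ z, ENNReal.ofReal (((N + 1 : ℕ) : ℝ)⁻¹ *
      participation σ N ((Φ N).flow (t - Δ N) z) (steps σ N ((Φ N).flow (t - Δ N) z) (Δ N)))
    ∂(Literature.MathematicalPhysics.KineticTheory.localGibbsLaw σ a₀ u₀ θ₀ N (Φ N)))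
    atTop (𝓝 0)

/-! ## Registered stubs -/

/-- STUB 1 (KINSHIP, deterministic, M). The exact bookkeeping of the typed fold: row budget,
locality, the unit swap rule and the kinship identity, for every `σ`, `N`, `y`, `m`
(induction on `m` over `List.range`, `collidePair_apply_left/right/of_ne`, `reflectVel` with
`P = νν̂ᵀ`, orthogonality of the partial transfer for `Σₖ x_k = 1`). Proved at the two-row scalar
level in KinshipProof.lean / GainProof.lean (evidence on the item); this is the fold-level lift. -/
theorem stub_kinship : ∀ σ : ℝ, Kinship σ := by
  sorry

/-- STUB 2 (DRIFT — no conspiracy; load-bearing, hardest, L/XL). Given the bookkeeping, for all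
nice profiles there is `σ₀ > 0` such that for `0 < σ < σ₀`, every flow family, every admissible
window and every `t > 0` some rate `κ > 0` satisfies `DriftAt κ …`: in local-Gibbs mean and
uniformly over sub-intervals of the window, the realised `|g·ν|`-selected normals achieve a
fixed fraction of perfect row averaging, net of recollision (clone) collisions — an `O(σ³)`
fraction of all collisions at small `σ` — and of the isotropic noise floor. Why it might fail:
adapted normals or weight-carrying transient clusters could make `E[ΔI + κD] > 0` in aggregate on
some sub-interval, N-uniformly; no estimate along the non-equilibrium law beyond energy/entropy is
in print. -/
theorem stub_drift :
    (∀ σ : ℝ, Kinship σ) →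
    ∀ (a₀ θ₀ : UnitAddTorus (Fin 3) → ℝ) (u₀ : UnitAddTorus (Fin 3) → EuclideanSpace ℝ (Fin 3)),
      NiceProfiles a₀ θ₀ u₀ →
      ∃ σ₀ : ℝ, 0 < σ₀ ∧ ∀ σ : ℝ, 0 < σ → σ < σ₀ →
        ∀ (Φ : Flows σ) (Δ : ℕ → ℝ), AdmissibleWindow Δ → ∀ t : ℝ, 0 < t →
          ∃ κ : ℝ, 0 < κ ∧ DriftAt κ σ a₀ θ₀ u₀ Φ Δ t := by
  sorry

/-- STUB 3 (FEW IDLE PARTICLES, L). For all nice profiles there is `σ₀ > 0` such that for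
`0 < σ < σ₀`, every flow family, admissible window, `t > 0` and every fixed number `L ≥ 1` of
epochs, the mean number of particles without a collision during an epoch (`n_N / L → ∞` mean free
times) is `o(N+1)` — the `m = 0` case of FewCollisionsRare, N-uniform along the NON-equilibrium
law (equilibrium version: super-exponential by ballistic tubes; transfer by the `O(N)` entropy
budget). Why it might fail: comoving cold clusters at positive density under the evolved law. -/
theorem stub_fewIdle :
    ∀ (a₀ θ₀ : UnitAddTorus (Fin 3) → ℝ) (u₀ : UnitAddTorus (Fin 3) → EuclideanSpace ℝ (Fin 3)),
      NiceProfiles a₀ θ₀ u₀ →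
      ∃ σ₀ : ℝ, 0 < σ₀ ∧ ∀ σ : ℝ, 0 < σ → σ < σ₀ →
        ∀ (Φ : Flows σ) (Δ : ℕ → ℝ), AdmissibleWindow Δ → ∀ t : ℝ, 0 < t →
          ∀ L : ℕ, 0 < L → FewIdleAt σ a₀ θ₀ u₀ Φ Δ t L := by
  sorry

/-- STUB 4 (SUPPLY from few idle particles, L). Given the bookkeeping (locality: a row is frozen
until its particle collides), for small `σ` and every `(Φ, Δ, t)`: if every epoch leaves only
`o(N+1)` particles idle (for every `L ≥ 1`), then for some `c > 0` independent of `L` the epochs'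
collisions dissipate discrepancy `≥ c · I(epoch start)` up to `o(N+1)` in mean — the first
collision of a particle in an epoch meets a row which is not a near-clone of its own
(`2K_pq ≤ (1−c)(ipr_p + ipr_q)`) except on a set of particles carrying a vanishing share of the
participation. Why it might fail: transient closed clusters (repeated mutual recollisions shielded
from third parties) holding a macroscopic share of `I` for a whole epoch. Tools: kinship bound
`K ≤ √(ipr_p ipr_q)`, finite collision numbers of isolated clusters (Burago–Ferleger–Kononenko). -/
theorem stub_supply :
    (∀ σ : ℝ, Kinship σ) →
    ∀ (a₀ θ₀ : UnitAddTorus (Fin 3) → ℝ) (u₀ : UnitAddTorus (Fin 3) → EuclideanSpace ℝ (Fin 3)),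
      NiceProfiles a₀ θ₀ u₀ →
      ∃ σ₀ : ℝ, 0 < σ₀ ∧ ∀ σ : ℝ, 0 < σ → σ < σ₀ →
        ∀ (Φ : Flows σ) (Δ : ℕ → ℝ), AdmissibleWindow Δ → ∀ t : ℝ, 0 < t →
          (∀ L : ℕ, 0 < L → FewIdleAt σ a₀ θ₀ u₀ Φ Δ t L) →
          ∃ c : ℝ, 0 < c ∧ ∀ L : ℕ, 0 < L → SupplyAt c σ a₀ θ₀ u₀ Φ Δ t L := by
  sorry

/-- STUB 5 (REDUCTION, analysis/measure theory, M). Bookkeeping + drift + supply imply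
delocalisation at `(σ, Φ, Δ, t)` for `0 < σ ≤ 1/2` (local Gibbs laws are probability measures):
with `s_ℓ = ℓΔ_N/L`, drift on each epoch and telescoping give
`κ Σ_ℓ E[D_ℓ] ≤ 9(N+1) + Lε_N(N+1)` (`I(0) ≤ 9(N+1)` by the budget); supply gives
`Σ_ℓ E[D_ℓ] ≥ c Σ_ℓ E[I(s_ℓ)] − o(N+1)`; drift on `[s_ℓ, Δ_N]` gives `E[I(Δ_N)] ≤ E[I(s_ℓ)] + ε_N(N+1)`;
hence `limsup_N E[ipr] ≤ 9/(κ c L)` for every `L`, and `L → ∞`. Needs measurability of the fold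
functionals along the flow (support lemma). -/
theorem stub_reduction :
    (∀ σ : ℝ, Kinship σ) →
    ∀ (a₀ θ₀ : UnitAddTorus (Fin 3) → ℝ) (u₀ : UnitAddTorus (Fin 3) → EuclideanSpace ℝ (Fin 3)),
      NiceProfiles a₀ θ₀ u₀ →
      ∀ σ : ℝ, 0 < σ → σ ≤ 1 / 2 →
        ∀ (Φ : Flows σ) (Δ : ℕ → ℝ), AdmissibleWindow Δ → ∀ t : ℝ, 0 < t →
          (∃ κ : ℝ, 0 < κ ∧ DriftAt κ σ a₀ θ₀ u₀ Φ Δ t) →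
          (∃ c : ℝ, 0 < c ∧ ∀ L : ℕ, 0 < L → SupplyAt c σ a₀ θ₀ u₀ Φ Δ t L) →
          Delocalises σ a₀ θ₀ u₀ Φ Δ t := by
  sorry

/-! ## Composition -/

/-- The five stubs imply the crux `CollisionIsometryCLT.DiffuseBackwardInfluence` BY NAME:
`σ₀ := min (min σ_drift σ_idle) (min σ_supply (1/2))`; the crux's `let M …; let ipr …` conclusion
is definitionally `Delocalises σ a₀ θ₀ u₀ Φ Δ t`. -/
theorem DiffuseBackwardInfluence_of :
    (∀ σ : ℝ, Kinship σ) →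
    ((∀ σ : ℝ, Kinship σ) →
      ∀ (a₀ θ₀ : UnitAddTorus (Fin 3) → ℝ) (u₀ : UnitAddTorus (Fin 3) → EuclideanSpace ℝ (Fin 3)),
        NiceProfiles a₀ θ₀ u₀ →
        ∃ σ₀ : ℝ, 0 < σ₀ ∧ ∀ σ : ℝ, 0 < σ → σ < σ₀ →
          ∀ (Φ : Flows σ) (Δ : ℕ → ℝ), AdmissibleWindow Δ → ∀ t : ℝ, 0 < t →
            ∃ κ : ℝ, 0 < κ ∧ DriftAt κ σ a₀ θ₀ u₀ Φ Δ t) →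
    (∀ (a₀ θ₀ : UnitAddTorus (Fin 3) → ℝ) (u₀ : UnitAddTorus (Fin 3) → EuclideanSpace ℝ (Fin 3)),
        NiceProfiles a₀ θ₀ u₀ →
        ∃ σ₀ : ℝ, 0 < σ₀ ∧ ∀ σ : ℝ, 0 < σ → σ < σ₀ →
          ∀ (Φ : Flows σ) (Δ : ℕ → ℝ), AdmissibleWindow Δ → ∀ t : ℝ, 0 < t →
            ∀ L : ℕ, 0 < L → FewIdleAt σ a₀ θ₀ u₀ Φ Δ t L) →
    ((∀ σ : ℝ, Kinship σ) →
      ∀ (a₀ θ₀ : UnitAddTorus (Fin 3) → ℝ) (u₀ : UnitAddTorus (Fin 3) → EuclideanSpace ℝ (Fin 3)),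
        NiceProfiles a₀ θ₀ u₀ →
        ∃ σ₀ : ℝ, 0 < σ₀ ∧ ∀ σ : ℝ, 0 < σ → σ < σ₀ →
          ∀ (Φ : Flows σ) (Δ : ℕ → ℝ), AdmissibleWindow Δ → ∀ t : ℝ, 0 < t →
            (∀ L : ℕ, 0 < L → FewIdleAt σ a₀ θ₀ u₀ Φ Δ t L) →
            ∃ c : ℝ, 0 < c ∧ ∀ L : ℕ, 0 < L → SupplyAt c σ a₀ θ₀ u₀ Φ Δ t L) →
    ((∀ σ : ℝ, Kinship σ) →
      ∀ (a₀ θ₀ : UnitAddTorus (Fin 3) → ℝ) (u₀ : UnitAddTorus (Fin 3) → EuclideanSpace ℝ (Fin 3)),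
        NiceProfiles a₀ θ₀ u₀ →
        ∀ σ : ℝ, 0 < σ → σ ≤ 1 / 2 →
          ∀ (Φ : Flows σ) (Δ : ℕ → ℝ), AdmissibleWindow Δ → ∀ t : ℝ, 0 < t →
            (∃ κ : ℝ, 0 < κ ∧ DriftAt κ σ a₀ θ₀ u₀ Φ Δ t) →
            (∃ c : ℝ, 0 < c ∧ ∀ L : ℕ, 0 < L → SupplyAt c σ a₀ θ₀ u₀ Φ Δ t L) →
            Delocalises σ a₀ θ₀ u₀ Φ Δ t) →
    Summit.AtomisticToContinuum.HydrodynamicLimit.Theses.CollisionIsometryCLT.DiffuseBackwardInfluence := by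
  intro hK hD hI hS hR a₀ θ₀ u₀ ha hθ hu ha0 hθ0
  have hP : NiceProfiles a₀ θ₀ u₀ := ⟨ha, hθ, hu, ha0, hθ0⟩
  obtain ⟨σ₁, hσ₁, H1⟩ := hD hK a₀ θ₀ u₀ hP
  obtain ⟨σ₂, hσ₂, H2⟩ := hI a₀ θ₀ u₀ hP
  obtain ⟨σ₃, hσ₃, H3⟩ := hS hK a₀ θ₀ u₀ hP
  refine ⟨min (min σ₁ σ₂) (min σ₃ (1 / 2)), ?_, ?_⟩
  · exact lt_min (lt_min hσ₁ hσ₂) (lt_min hσ₃ (by norm_num))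
  intro σ hσ hσlt
  have h1 : σ < σ₁ := lt_of_lt_of_le hσlt ((min_le_left _ _).trans (min_le_left _ _))
  have h2 : σ < σ₂ := lt_of_lt_of_le hσlt ((min_le_left _ _).trans (min_le_right _ _))
  have h3 : σ < σ₃ := lt_of_lt_of_le hσlt ((min_le_right _ _).trans (min_le_left _ _))
  have h4 : σ ≤ 1 / 2 := (lt_of_lt_of_le hσlt ((min_le_right _ _).trans (min_le_right _ _))).le
  intro M ipr Φ Δ hΔpos hΔ0 hΔinf t ht
  have hadm : AdmissibleWindow Δ := ⟨hΔpos, hΔ0, hΔinf⟩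
  obtain ⟨κ, hκ, hdrift⟩ := H1 σ hσ h1 Φ Δ hadm t ht
  have hidle : ∀ L : ℕ, 0 < L → FewIdleAt σ a₀ θ₀ u₀ Φ Δ t L :=
    fun L hL => H2 σ hσ h2 Φ Δ hadm t ht L hL
  obtain ⟨c, hc, hsup⟩ := H3 σ hσ h3 Φ Δ hadm t ht hidle
  exact hR hK a₀ θ₀ u₀ hP σ hσ h4 Φ Δ hadm t ht ⟨κ, hκ, hdrift⟩ ⟨c, hc, hsup⟩

/-- The skeleton theorem with the stubs plugged in (no hypotheses; `sorry` lives only in the five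
registered stubs it invokes — once they are proved this IS the crux proof). -/
theorem DiffuseBackwardInfluence_of_stubs :
    Summit.AtomisticToContinuum.HydrodynamicLimit.Theses.CollisionIsometryCLT.DiffuseBackwardInfluence :=
  DiffuseBackwardInfluence_of stub_kinship stub_drift stub_fewIdle stub_supply stub_reduction

end

end Summit.AtomisticToContinuum.HydrodynamicLimit.Cruxes.DiffuseBackwardInfluence.KinshipLyapunov
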